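import Mathlib.RingTheory.AdjoinRoot
import Mathlib.RingTheory.Localization.Algebra
import Mathlib.RingTheory.Localization.AtPrime.Basic
import Mathlib.RingTheory.Localization.Ideal
import Mathlib.RingTheory.Ideal.GoingUp
import Mathlib.RingTheory.LocalRing.ResidueField.Basic
import Mathlib.Algebra.Polynomial.Taylor
import HarnessLib

/-!
# [OURS · L1 W4.2] `Corridor3WLadderCPFrameLocalChart` — D18 brick (P2b), local reading: `(S[X]/(g))_𝔔 = S_q[X]/(g)` is
# LOCAL of the form `R'[X]/(monic)` when the fibre polynomial at `q` is `(X - θ)^m`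

Crux chain w42 (`SigmaMaxModifications`, stmt-ResolutionOfSingularities-18506; conjunct stmt-ResolutionOfSingularities-19249),
object D18 «HYPERSURFACE PROPAGATION + ADAPTED-FRAME EXISTENCE», clause (P2b) «chart identification», local half (res-D-pv-050 cut
09:33:13Z). Helper file `--supports stmt-ResolutionOfSingularities-19249 --as helper` (counted 0). OURS; NOT statements of
H. Hironaka's manuscript [Hironaka2017]; AI-written, weaker than expert review. Pure commutative algebra over Mathlib.

WHAT. `…CPFramePolynomialChart` (p526498) identified the `u_{j₀}`-chart of the blow-up of the CP-frame hypersurface `R[X]/(h)` along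
`V(X, u_J)` with `S[X']/(h')`, `S = R[I_J/u_{j₀}]`, `h'` the monic transform. The local ring at a point `z` of that chart is a
localisation `(S[X']/(h'))_𝔔`. HERE: if the fibre polynomial of `h'` at `q = 𝔔 ∩ S` is `(X' - θ̄)^m` — the shape forced at a NEAR
point (multiplicity `m` persists), with `θ̄` rational over `κ(q)` — then `(S[X']/(h'))_𝔔 = S_q[X']/(h')` is LOCAL, i.e. again
«regular local ring adjoined a monic hypersurface», and `𝔔` is the unique prime over `q`:

* `isLocalization_adjoinRoot_map` — `AdjoinRoot (g^{S_M})` is the localisation of `AdjoinRoot g` at `M` (any submonoid);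
* `isLocalRing_adjoinRoot_of_fibre` — over a local `S`, `S[X]/(g)` is local with maximal ideal `𝔪_S + (x - θ)` when
  `g ≡ (X - θ)^m (mod 𝔪_S)`;
* `isLocalization_atPrime_of_comap_maximalIdeal` — a local localisation at `(S ∖ q)·1` is the localisation at the contracted prime;
* `adjoinRoot_localization_of_fibre` — the package (locality, maximal ideal, `𝔔 ∩ S = q`, `B_q = B_𝔔`, uniqueness of `𝔔`).

What is NOT here (named for the successor): the scheme glue `𝒪_{Y_B,z} ≅ (B[J̄/ā])_𝔔` (tree `IsBlowup.exists_blowupAlgebra_stalk_ringEquiv`,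
`BlowupsFlatBaseChange`), the near-point shape lemma («`h' ∈ 𝔔^{(m)}` ⇒ fibre polynomial `(X' - θ̄)^m`», from (P3) p518570), the
completion base change (P2c) and minimality ((P4), binder hVP of p521363).
-/

noncomputable section

set_option linter.dupNamespace false

open Polynomial IsLocalRing

namespace Summit.ResolutionOfSingularities.ResolutionOfSingularities.Theorems.SigmaMaxModificationsCorridor3.Moving

universe u v

/-! ## Adjoining a root commutes with localisation -/

/-- [OURS · L1 W4.2] **`S_M[X]/(g) = (S[X]/(g)) ⊗ S_M` is the localisation of `S[X]/(g)` at the image of `M`**: for any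
localisation `T` of `S` at a submonoid `M` and any `g ∈ S[X]`, `AdjoinRoot (g^T)` — an `AdjoinRoot g`-algebra through
`AdjoinRoot.map` — is the localisation of `AdjoinRoot g` at `M · 1`. (Mathlib: `T[X]` is the localisation of `S[X]` at `C(M)`,
`Polynomial.isLocalization`; pass to the quotients by `(g)` with `IsLocalization.of_surjective`.) [folklore] -/
theorem isLocalization_adjoinRoot_map {S : Type u} [CommRing S] (M : Submonoid S) (T : Type v) [CommRing T]
    [Algebra S T] [IsLocalization M T] (g : S[X]) :
    letI := (AdjoinRoot.map (algebraMap S T) g (g.map (algebraMap S T)) dvd_rfl).toAlgebra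
    IsLocalization (Algebra.algebraMapSubmonoid (AdjoinRoot g) M) (AdjoinRoot (g.map (algebraMap S T))) := by
  letI hT : Algebra S[X] T[X] := Polynomial.algebra S T
  haveI : IsLocalization (M.map (C : S →+* S[X])) T[X] := Polynomial.isLocalization M T
  letI := (AdjoinRoot.map (algebraMap S T) g (g.map (algebraMap S T)) dvd_rfl).toAlgebra
  have hsub : (M.map (C : S →+* S[X])).map (AdjoinRoot.mk g : S[X] →+* AdjoinRoot g) =
      Algebra.algebraMapSubmonoid (AdjoinRoot g) M := by
    ext x
    simp only [Submonoid.mem_map, Algebra.algebraMapSubmonoid, AdjoinRoot.algebraMap_eq]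
    constructor
    · rintro ⟨_, ⟨s, hs, rfl⟩, rfl⟩
      exact ⟨s, hs, (AdjoinRoot.mk_C s).symm⟩
    · rintro ⟨s, hs, rfl⟩
      exact ⟨C s, ⟨s, hs, rfl⟩, AdjoinRoot.mk_C s⟩
  rw [← hsub]
  refine IsLocalization.of_surjective (M := M.map (C : S →+* S[X])) (S := T[X]) (AdjoinRoot.mk g)
    AdjoinRoot.mk_surjective (AdjoinRoot.mk (g.map (algebraMap S T))) AdjoinRoot.mk_surjective ?_ ?_
  · refine Polynomial.ringHom_ext (fun s => ?_) ?_
    · rw [RingHom.comp_apply, RingHom.comp_apply, Polynomial.algebraMap_def, coe_mapRingHom, map_C, AdjoinRoot.mk_C,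
        AdjoinRoot.mk_C, RingHom.algebraMap_toAlgebra, AdjoinRoot.map_of]
    · rw [RingHom.comp_apply, RingHom.comp_apply, Polynomial.algebraMap_def, coe_mapRingHom, map_X, AdjoinRoot.mk_X,
        AdjoinRoot.mk_X, RingHom.algebraMap_toAlgebra, AdjoinRoot.map_root]
  · intro x hx
    rw [RingHom.mem_ker, AdjoinRoot.mk_eq_zero] at hx
    obtain ⟨r, rfl⟩ := hx
    refine Ideal.mul_mem_right _ _ ?_
    have h1 : g ∈ RingHom.ker (AdjoinRoot.mk g : S[X] →+* AdjoinRoot g) := by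
      rw [RingHom.mem_ker, AdjoinRoot.mk_self]
    have h2 := Ideal.mem_map_of_mem (algebraMap S[X] T[X]) h1
    rwa [Polynomial.algebraMap_def, coe_mapRingHom] at h2

/-! ## `S[X]/(g)` is local when the fibre polynomial is `(X - θ)^m` -/

/-- [OURS · L1 W4.2] **Locality of `S[X]/(g)` over a local `S` when `g ≡ (X - θ)^m (mod 𝔪_S)`.** If `S` is local, `g ∈ S[X]` is
monic of degree `m ≥ 1` and all lower coefficients of `g(X + θ)` lie in `𝔪_S` (i.e. the fibre polynomial `ḡ ∈ κ_S[X]` is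
`(X - θ̄)^m`), then `AdjoinRoot g = S[X]/(g)` is a LOCAL ring with maximal ideal `𝔪_S · S[X]/(g) + (x - θ)` (`x` the class of
`X`): the evaluation `X ↦ θ̄` onto `κ_S` has that kernel (division by `X - θ`), which is maximal; every maximal ideal contracts to
`𝔪_S` (the extension is finite, `Polynomial.Monic.finite_adjoinRoot`, hence integral) and contains `x - θ` because
`(x - θ)^m ∈ 𝔪_S S[X]/(g)` (expand `g(X + θ)` at `x - θ`). This is the shape of the local ring of the transform of a CP frame at a
NEAR point of the blow-up (multiplicity `m` persists ⇒ the fibre polynomial of the monic transform `h'` is an `m`-th power of a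
linear form). [folklore] -/
theorem isLocalRing_adjoinRoot_of_fibre {S : Type u} [CommRing S] [IsLocalRing S] {g : S[X]} (hg : g.Monic)
    (hdeg : 0 < g.natDegree) (θ : S) (hθ : ∀ i < g.natDegree, (g.comp (X + C θ)).coeff i ∈ maximalIdeal S) :
    ∃ _ : IsLocalRing (AdjoinRoot g), maximalIdeal (AdjoinRoot g) =
      (maximalIdeal S).map (AdjoinRoot.of g) ⊔ Ideal.span {AdjoinRoot.root g - AdjoinRoot.of g θ} := by
  set M₀ : Ideal (AdjoinRoot g) :=
    (maximalIdeal S).map (AdjoinRoot.of g) ⊔ Ideal.span {AdjoinRoot.root g - AdjoinRoot.of g θ} with hM₀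
  -- the evaluation `X ↦ θ̄` to the residue field
  have hgθ : g.eval θ ∈ maximalIdeal S := by
    have h1 : g.eval θ = (g.comp (X + C θ)).coeff 0 := by
      rw [coeff_zero_eq_eval_zero, eval_comp, eval_add, eval_X, eval_C, zero_add]
    rw [h1]
    exact hθ 0 hdeg
  have hev0 : g.eval₂ (residue S) (residue S θ) = 0 := by
    rw [eval₂_hom, (residue_eq_zero_iff _).mpr hgθ]
  let lam : AdjoinRoot g →+* ResidueField S := AdjoinRoot.lift (residue S) (residue S θ) hev0
  have hlam_of : ∀ s, lam (AdjoinRoot.of g s) = residue S s := fun s => AdjoinRoot.lift_of hev0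
  have hlam_root : lam (AdjoinRoot.root g) = residue S θ := AdjoinRoot.lift_root hev0
  have hlam_surj : Function.Surjective lam := fun r => by
    obtain ⟨s, rfl⟩ := residue_surjective r
    exact ⟨AdjoinRoot.of g s, hlam_of s⟩
  -- its kernel is `M₀`
  have hker : RingHom.ker lam = M₀ := by
    apply le_antisymm
    · intro b hb
      obtain ⟨p, rfl⟩ := AdjoinRoot.mk_surjective b
      have hp : AdjoinRoot.mk g p = AdjoinRoot.of g (p.eval θ) +
          (AdjoinRoot.root g - AdjoinRoot.of g θ) * AdjoinRoot.mk g (p /ₘ (X - C θ)) := by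
        conv_lhs => rw [← modByMonic_add_div p (X - C θ), modByMonic_X_sub_C_eq_C_eval]
        rw [map_add, map_mul, AdjoinRoot.mk_C, map_sub, AdjoinRoot.mk_X, AdjoinRoot.mk_C]
      rw [RingHom.mem_ker, hp, map_add, map_mul, map_sub, hlam_root, hlam_of, hlam_of, sub_self, zero_mul, add_zero,
        residue_eq_zero_iff] at hb
      rw [hp]
      exact Ideal.add_mem _ (Ideal.mem_sup_left (Ideal.mem_map_of_mem _ hb))
        (Ideal.mem_sup_right (Ideal.mul_mem_right _ _ (Ideal.mem_span_singleton_self _)))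
    · refine sup_le ?_ ?_
      · rw [Ideal.map_le_iff_le_comap]
        intro s hs
        rw [Ideal.mem_comap, RingHom.mem_ker, hlam_of, residue_eq_zero_iff]
        exact hs
      · rw [Ideal.span_le, Set.singleton_subset_iff, SetLike.mem_coe, RingHom.mem_ker, map_sub, hlam_root, hlam_of,
          sub_self]
  have hKmax : M₀.IsMaximal := by
    rw [← hker]
    refine Ideal.Quotient.maximal_of_isField _ ?_
    exact MulEquiv.isField (Field.toIsField (ResidueField S))
      (RingHom.quotientKerEquivOfSurjective hlam_surj).toMulEquiv
  -- every maximal ideal contains `M₀`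
  haveI : Module.Finite S (AdjoinRoot g) := hg.finite_adjoinRoot
  have hpow : (AdjoinRoot.root g - AdjoinRoot.of g θ) ^ g.natDegree ∈ (maximalIdeal S).map (AdjoinRoot.of g) := by
    set y := AdjoinRoot.root g - AdjoinRoot.of g θ with hy
    set g₁ := g.comp (X + C θ) with hg₁
    have hdeg₁ : g₁.natDegree = g.natDegree := by rw [hg₁, ← taylor_apply, natDegree_taylor]
    have hmon₁ : g₁.Monic := hg.comp_X_add_C θ
    have hev : g₁.eval₂ (AdjoinRoot.of g) y = 0 := by
      rw [hg₁, eval₂_comp, eval₂_add, eval₂_X, eval₂_C, hy, sub_add_cancel, AdjoinRoot.eval₂_root]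
    rw [eval₂_eq_sum_range, hdeg₁, Finset.sum_range_succ, ← hdeg₁, hmon₁.coeff_natDegree, map_one, one_mul, hdeg₁]
      at hev
    have h1 : y ^ g.natDegree = -∑ i ∈ Finset.range g.natDegree, AdjoinRoot.of g (g₁.coeff i) * y ^ i := by
      rw [eq_neg_iff_add_eq_zero, add_comm, hev]
    rw [h1, Ideal.neg_mem_iff]
    refine Ideal.sum_mem _ fun i hi => Ideal.mul_mem_right _ _ (Ideal.mem_map_of_mem _ (hθ i ?_))
    exact Finset.mem_range.mp hi
  have hle : ∀ 𝔑 : Ideal (AdjoinRoot g), 𝔑.IsMaximal → M₀ ≤ 𝔑 := by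
    intro 𝔑 h𝔑
    have hc : (𝔑.comap (algebraMap S (AdjoinRoot g))).IsMaximal := Ideal.isMaximal_comap_of_isIntegral_of_isMaximal 𝔑
    have hc' : maximalIdeal S ≤ 𝔑.comap (AdjoinRoot.of g) := by
      rw [← AdjoinRoot.algebraMap_eq, ← eq_maximalIdeal hc]
    have h1 : (maximalIdeal S).map (AdjoinRoot.of g) ≤ 𝔑 := Ideal.map_le_iff_le_comap.mpr hc'
    refine sup_le h1 ?_
    rw [Ideal.span_le, Set.singleton_subset_iff, SetLike.mem_coe]
    exact h𝔑.isPrime.mem_of_pow_mem _ (h1 hpow)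
  have hloc : IsLocalRing (AdjoinRoot g) :=
    IsLocalRing.of_unique_max_ideal ⟨M₀, hKmax, fun 𝔑 h𝔑 => (hKmax.eq_of_le h𝔑.ne_top (hle 𝔑 h𝔑)).symm⟩
  exact ⟨hloc, (eq_maximalIdeal hKmax).symm⟩

/-! ## Localising at the prime under the maximal ideal -/

/-- [OURS · L1 W4.2] **A local localisation is the localisation at a prime.** Let `T` be a localisation of the `S`-algebra `B` at
`(S ∖ q) · 1` which is a LOCAL ring, and `𝔔 ⊆ B` the contraction of `𝔪_T`; if `𝔔 ∩ S ⊆ q` then `T = B_𝔔`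
(`IsLocalization.AtPrime T 𝔔`): the elements of `B ∖ 𝔔` become units in `T` (Mathlib `IsLocalization.of_le`). [folklore] -/
theorem isLocalization_atPrime_of_comap_maximalIdeal {S : Type u} {B : Type v} {T : Type*} [CommRing S] [CommRing B]
    [CommRing T] [Algebra S B] [Algebra B T] (q : Ideal S) [q.IsPrime]
    [IsLocalization (Algebra.algebraMapSubmonoid B q.primeCompl) T] [IsLocalRing T]
    (𝔔 : Ideal B) [𝔔.IsPrime] (h𝔔 : (maximalIdeal T).comap (algebraMap B T) = 𝔔)
    (hq : 𝔔.comap (algebraMap S B) ≤ q) : IsLocalization.AtPrime T 𝔔 := by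
  refine IsLocalization.of_le (Algebra.algebraMapSubmonoid B q.primeCompl) 𝔔.primeCompl ?_ ?_
  · rintro _ ⟨s, hs, rfl⟩
    intro hmem
    exact hs (hq hmem)
  · intro b hb
    by_contra hu
    have : b ∈ (maximalIdeal T).comap (algebraMap B T) := (mem_maximalIdeal _).mpr hu
    rw [h𝔔] at this
    exact hb this

/-! ## The package for `AdjoinRoot` -/

/-- [OURS · L1 W4.2] **(P2b), local reading.** `S` any commutative ring, `q` a prime, `g ∈ S[X]` monic of degree `m ≥ 1` whose
image `g_q ∈ S_q[X]` has fibre polynomial `(X - θ̄)^m` for some `θ ∈ S_q` (lower coefficients of `g_q(X + θ)` in `𝔪_{S_q}`). Then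
`B_q := S_q[X]/(g_q)` (`AdjoinRoot g_q`) is LOCAL with maximal ideal `𝔪_{S_q} B_q + (x - θ)`; the contraction `𝔔` of its maximal
ideal to `B := S[X]/(g)` lies over `q`; `B_q` IS the localisation `B_𝔔` (along `AdjoinRoot.map`); and `𝔔` is the ONLY prime of
`B` over `q` (incomparability of primes in the finite extension `S → B`, Mathlib `Ideal.comap_lt_comap_of_integral_mem_sdiff`).
Read with `S = R[I_J/u_{j₀}]`, `g = h'` the monic transform (`…CPFramePolynomialChart`, p526498): at a near point `z` of the
blow-up of the CP-frame hypersurface, `𝒪_z = (R[I_J/u_{j₀}][X']/(h'))_𝔔 = R'[X']/(h')` with `R' = R[I_J/u_{j₀}]_𝔮` regular local —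
again a hypersurface frame, ready for the translation `X'' = X' - θ` of `…CPFrameTranslate` (p521363). [folklore] -/
theorem adjoinRoot_localization_of_fibre {S : Type u} [CommRing S] (q : Ideal S) [q.IsPrime] {g : S[X]} (hg : g.Monic)
    (hdeg : 0 < g.natDegree) (θ : Localization.AtPrime q)
    (hθ : ∀ i < g.natDegree, ((g.map (algebraMap S (Localization.AtPrime q))).comp (X + C θ)).coeff i ∈
      maximalIdeal (Localization.AtPrime q)) :
    ∃ _ : IsLocalRing (AdjoinRoot (g.map (algebraMap S (Localization.AtPrime q)))),
      maximalIdeal (AdjoinRoot (g.map (algebraMap S (Localization.AtPrime q)))) =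
        (maximalIdeal (Localization.AtPrime q)).map (AdjoinRoot.of _) ⊔
          Ideal.span {AdjoinRoot.root _ - AdjoinRoot.of _ θ} ∧
      ((maximalIdeal (AdjoinRoot (g.map (algebraMap S (Localization.AtPrime q))))).comap
        (AdjoinRoot.map (algebraMap S (Localization.AtPrime q)) g _ dvd_rfl)).comap (AdjoinRoot.of g) = q ∧
      (letI := (AdjoinRoot.map (algebraMap S (Localization.AtPrime q)) g
          (g.map (algebraMap S (Localization.AtPrime q))) dvd_rfl).toAlgebra;
        IsLocalization.AtPrime (AdjoinRoot (g.map (algebraMap S (Localization.AtPrime q))))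
          (Ideal.comap (AdjoinRoot.map (algebraMap S (Localization.AtPrime q)) g _ dvd_rfl)
            (maximalIdeal (AdjoinRoot (g.map (algebraMap S (Localization.AtPrime q))))))) ∧
      (∀ 𝔔' : Ideal (AdjoinRoot g), 𝔔'.IsPrime → 𝔔'.comap (AdjoinRoot.of g) = q →
        𝔔' = (maximalIdeal (AdjoinRoot (g.map (algebraMap S (Localization.AtPrime q))))).comap
          (AdjoinRoot.map (algebraMap S (Localization.AtPrime q)) g _ dvd_rfl)) := by
  have hmonq : (g.map (algebraMap S (Localization.AtPrime q))).Monic := hg.map _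
  have hdegq : (g.map (algebraMap S (Localization.AtPrime q))).natDegree = g.natDegree := hg.natDegree_map _
  obtain ⟨hloc, hmax⟩ := isLocalRing_adjoinRoot_of_fibre hmonq (hdegq.symm ▸ hdeg) θ (fun i hi => hθ i (hdegq ▸ hi))
  letI := (AdjoinRoot.map (algebraMap S (Localization.AtPrime q)) g (g.map (algebraMap S (Localization.AtPrime q))) dvd_rfl).toAlgebra
  haveI := isLocalization_adjoinRoot_map q.primeCompl (Localization.AtPrime q) g
  haveI : Module.Finite (Localization.AtPrime q) (AdjoinRoot (g.map (algebraMap S (Localization.AtPrime q)))) := hmonq.finite_adjoinRoot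
  haveI : Module.Finite S (AdjoinRoot g) := hg.finite_adjoinRoot
  -- `𝔔 ∩ S = q`
  have hι_of : (AdjoinRoot.map (algebraMap S (Localization.AtPrime q)) g (g.map (algebraMap S (Localization.AtPrime q))) dvd_rfl).comp (AdjoinRoot.of g) = (AdjoinRoot.of (g.map (algebraMap S (Localization.AtPrime q)))).comp (algebraMap S (Localization.AtPrime q)) :=
    RingHom.ext fun s => by rw [RingHom.comp_apply, RingHom.comp_apply, AdjoinRoot.map_of]
  have hmSq : (maximalIdeal (AdjoinRoot (g.map (algebraMap S (Localization.AtPrime q))))).comap (AdjoinRoot.of (g.map (algebraMap S (Localization.AtPrime q)))) = maximalIdeal (Localization.AtPrime q) := by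
    rw [← AdjoinRoot.algebraMap_eq]
    exact eq_maximalIdeal (Ideal.isMaximal_comap_of_isIntegral_of_isMaximal (R := (Localization.AtPrime q))
      (maximalIdeal (AdjoinRoot (g.map (algebraMap S (Localization.AtPrime q))))))
  have hq : ((maximalIdeal (AdjoinRoot (g.map (algebraMap S (Localization.AtPrime q))))).comap (AdjoinRoot.map (algebraMap S (Localization.AtPrime q)) g (g.map (algebraMap S (Localization.AtPrime q))) dvd_rfl)).comap (AdjoinRoot.of g) = q := by
    rw [Ideal.comap_comap, hι_of, ← Ideal.comap_comap, hmSq]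
    exact Localization.AtPrime.under_maximalIdeal
  refine ⟨hloc, hmax, hq, ?_, ?_⟩
  · exact isLocalization_atPrime_of_comap_maximalIdeal q _ rfl (by rw [AdjoinRoot.algebraMap_eq, hq])
  · intro 𝔔' h𝔔' hq'
    have hdisj : Disjoint (Algebra.algebraMapSubmonoid (AdjoinRoot g) q.primeCompl : Set (AdjoinRoot g)) 𝔔' := by
      refine Set.disjoint_left.mpr ?_
      rintro _ ⟨s, hs, rfl⟩ hmem
      refine hs ?_
      rw [← hq']
      rw [SetLike.mem_coe, AdjoinRoot.algebraMap_eq] at hmem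
      exact Ideal.mem_comap.mpr hmem
    have hprime := IsLocalization.isPrime_of_isPrime_disjoint (Algebra.algebraMapSubmonoid (AdjoinRoot g) q.primeCompl)
      (AdjoinRoot (g.map (algebraMap S (Localization.AtPrime q)))) 𝔔' h𝔔' hdisj
    have hle : 𝔔' ≤ (maximalIdeal (AdjoinRoot (g.map (algebraMap S (Localization.AtPrime q))))).comap (AdjoinRoot.map (algebraMap S (Localization.AtPrime q)) g (g.map (algebraMap S (Localization.AtPrime q))) dvd_rfl) := by
      have h1 := IsLocalization.under_map_of_isPrime_disjoint (Algebra.algebraMapSubmonoid (AdjoinRoot g) q.primeCompl)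
        (AdjoinRoot (g.map (algebraMap S (Localization.AtPrime q)))) h𝔔' hdisj
      rw [← h1, Ideal.under_def, RingHom.algebraMap_toAlgebra]
      exact Ideal.comap_mono (le_maximalIdeal hprime.ne_top)
    by_contra hne
    have hlt : 𝔔' < (maximalIdeal (AdjoinRoot (g.map (algebraMap S (Localization.AtPrime q))))).comap (AdjoinRoot.map (algebraMap S (Localization.AtPrime q)) g (g.map (algebraMap S (Localization.AtPrime q))) dvd_rfl) := lt_of_le_of_ne hle hne
    obtain ⟨x, hx, hx'⟩ := SetLike.exists_of_lt hlt
    have hint : IsIntegral S x := Algebra.IsIntegral.isIntegral x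
    have h2 := Ideal.comap_lt_comap_of_integral_mem_sdiff hle ⟨hx, hx'⟩ hint
    rw [AdjoinRoot.algebraMap_eq, hq', hq] at h2
    exact lt_irrefl _ h2

end Summit.ResolutionOfSingularities.ResolutionOfSingularities.Theorems.SigmaMaxModificationsCorridor3.Moving

end
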